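import Mathlib
import Summits.NavierStokesRegularity.NavierStokesRegularity.Theorems.TaoLadderRungTwoBreakOneShiftWindowGridE
import Summits.NavierStokesRegularity.NavierStokesRegularity.Theorems.TaoLadderRungTwoBreakOneShiftWindowK3GlueC
import Summits.NavierStokesRegularity.NavierStokesRegularity.Theorems.TaoLadderRungTwoBreakOneShiftWindowGlGlueC
import HarnessLib

/-!
# The one-shift window system, LIX: THE ROW GLUE ON THE END-OF-STEP PRODUCT CHAIN, II — parts LIII/LIV verbatim
# (`K3_of_gridCE`, `gfac_mem_of_gridCE`, `gl_of_gridCE`) with the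
# product Boolean `prodOKE` of part LVII on the regular steps `s < S` and `prodOK S` on the final step: (K1), (K3) and
# the `g`-hull of a one-shift row from Booleans over emitted dyadic data + instance facts, now with a slope chain
# whose width is the second-order variation over the box instead of `Σ_s h_s‖Df‖`
# (cell harvest/h2-tao-ladder, seat p2; rung1/KERNEL-CHEAP-REPLAY-SPEC.md §10, RUNG1-P2G14-REPORT §67; support for
# K1(1) = `NoSurvivingDSSOne`, stmt-NavierStokesRegularity-20205)

MODEL lattice ODEs only (Tao 2016 §4 normal form on Tao's shift set `S`); nothing here is a statement about the
Navier–Stokes equations; no item is closed; no instance is evaluated here. Generic in the frame `F`, the numbering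
`e` and the term index `κ`.
-/

noncomputable section

-- the sub-problem namespace repeats the summit name by design (D-0017)
set_option linter.dupNamespace false

namespace Summit.NavierStokesRegularity.NavierStokesRegularity.Theorems

namespace DSSOneShift

open Set Finset Metric Filter Topology TopologicalSpace
open Literature.Analysis.ODE Literature.Analysis.FluidPDE Literature.Analysis.FluidPDE.TaoCascade
open Summit.NavierStokesRegularity.NavierStokesRegularity.Theorems.TaylorModelCert
open Summit.NavierStokesRegularity.NavierStokesRegularity.Theorems.TaylorModelReadout
open Summit.NavierStokesRegularity.NavierStokesRegularity.Theorems.CertificateGlueOn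

variable {m : ℕ}

namespace OneShiftFrame

variable (F : OneShiftFrame m)

section Glue

variable {ε₀ : ℝ} {α : Fin m → Fin m → Fin m → ℤ × ℤ × ℤ → ℝ} {R : ℤ → ℝ}
variable {g : GridCD} {kd : KrawD} {k3 : K3D} {e : F.SIdx ≃ Fin g.n}
variable {κ : Type*} [Fintype κ]

/-- **(K3) FROM THE CENTRED GRID, THE INTERVAL-TIME END BOX AND THE CENTRE-RESIDUAL BOOLEAN.** For a one-shift frame `F` at
`(ε₀, α)`, a centred grid `g` and a centre-residual datum `k3` whose Krawczyk datum matches the frame (`FrameMatch`), term data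
presenting the realisations (`hRDc`, `hRD`, `hTf`), all grid Booleans, `ŷ ∈ P_0`, `ŷ ∈ ycB`, `strig ∈ strigB`, `τc − t_S ∈ TI`,
the link `endBoxROnI P_S TI ⊆ Zc` and `K3D.check`: the centre residual clause (K3) of part V holds with `Y = YD` for the
linear preconditioner of `Cmat`. [cite: Tao2016AveragedNS, §5.3; Moore1979, §3.2 and §8.1; cell vocabulary, harvest/h2-tao-ladder rung1/STAGE2-LEMMA.md §3 (‖C G(x̂)‖ ≤ Y), rung1/KERNEL-CHEAP-REPLAY-SPEC.md §2/§9] -/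
theorem K3_of_gridCE (hε : 0 ≤ ε₀) (hα : IsCancellingCoeff α)
    (hEb : ∀ i, |F.tubeC i (-1)| + F.tubeR (-1) ≤ F.Eb) (hEt : ∀ i, |F.tubeC i F.W| + F.tubeR F.W ≤ F.Et)
    (M : F.FrameMatch g.toGridD k3.kd e R) (hkn : k3.kd.rs.n = g.n)
    (Tc : ℕ → κ → BTerm F.SIdx) (rows : F.SIdx → List κ) (Tf : F.Space → ℝ → κ → BTerm F.SIdx)
    (hTf : ∀ u, F.AdmLip R u → ∀ t x, termField (Tf u t) x = F.wfieldFlat ε₀ α (F.preclampTail u) t x)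
    (hRDc : ∀ s ≤ g.S, IsRTEncl (g.es e M.hn s) (Tc s) (Tc s) rows (g.step s).RD)
    (hRD : ∀ u, F.AdmLip R u → ∀ s ≤ g.S, ∀ r ∈ Ico 0 (g.h s).toReal,
      IsRTEncl (g.es e M.hn s) (Tc s) (Tf u (g.t s + r)) rows (g.step s).RD)
    (hstep : ∀ s ≤ g.S, g.stepOK s = true) (hinit : g.initOK = true) (hprod : ∀ s < g.S, g.prodOKE s = true)
    (hpwf : ∀ s ≤ g.S, g.pwfOK s = true) (hpsub : ∀ s ≤ g.S, g.psubOK s = true)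
    (hplink : ∀ s < g.S, g.plinkOK s = true) (hwlink : ∀ s < g.S, g.wlinkOK s = true)
    (hP0 : (fun c : F.SIdx => F.yc c.1 ((c.2 : ℕ) : ℤ)) ∈ boxSet (boxOf e (g.P 0)))
    (hyc : ∀ i (j : Fin F.W), IntervalD.mem (F.yc i ((j : ℕ) : ℤ)) (IntervalD.aget k3.ycB (e (i, j))))
    (hstrig : IntervalD.mem F.strig k3.strigB) (hTI : IntervalD.mem (F.τc - g.t g.S) k3.TI)
    (hzlink : ∀ c < g.n, IntervalD.subset ((g.step g.S).toRoughStepD.endBoxROnI (g.P g.S) k3.TI c) (IntervalD.aget k3.Zc c) = true)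
    (hK3 : k3.check = true) :
    ∀ u, F.AdmLip R u → u.1 = 0 → u.2.1 = 0 →
      (∀ i j, |(F.precondResidual ε₀ α (F.linOfMatrix (k3.kd.CmatR F (e.trans (finCongr hkn.symm)))) u).1 i j| ≤
        k3.YD.toReal) ∧
      |(F.precondResidual ε₀ α (F.linOfMatrix (k3.kd.CmatR F (e.trans (finCongr hkn.symm)))) u).2| ≤ k3.YD.toReal := by
  classical
  have hW1 := M.hW1
  have hDW := M.hDW
  have hn := M.hn
  have hW : 0 < F.W := lt_trans zero_lt_one hW1
  set ek : F.SIdx ≃ Fin k3.kd.rs.n := e.trans (finCongr hkn.symm) with hekdef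
  have hek : ∀ p : F.SIdx, ((ek p : Fin k3.kd.rs.n) : ℕ) = (e p : ℕ) := fun p => by simp [hekdef]
  refine F.K3_of_centreRun (F.linOfMatrix (k3.kd.CmatR F ek)) (F.coord_linOfMatrix (k3.kd.CmatR F ek)) R
    (k3.zlo F ek) (k3.zhi F ek) ?_ ?_
  swap
  · -- the finite check (part LII)
    exact k3.hY_of_check (F := F) (e := ek) hW1 hDW M.hm
      (fun i j => by
        have h := M.hsucc i j
        rw [hek, h]
        split_ifs with hj
        · rw [hek]
        · rfl)
      (fun i j => by rw [hek]; exact M.hmode i j) (fun i => by rw [hek]; exact M.hidx1 i)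
      (fun i => by rw [hek]; exact M.hidxD i) (fun i j => by rw [hek]; exact M.ha i j) M.hrτ M.hTtop
      (fun i j => by rw [hek]; exact hyc i j) hstrig hK3
  -- the hull of the centre run at the flight-time centre
  intro u hu h1 h2 i kk hk
  -- facts of the final step
  have hchkS : (g.step g.S).check = true := by
    have := hstep g.S le_rfl
    simp only [GridD.stepOK, Bool.and_eq_true, decide_eq_true_eq] at this
    exact this.1
  have hc' : (g.step g.S).toRoughStepD.check = true ∧ (g.step g.S).checkPair = true := by
    simpa [PairStepD.check, Bool.and_eq_true] using hchkS
  have hh : ∀ s ≤ g.S, 0 ≤ (g.h s).toReal := fun s hs => (g.h_nonneg_and_wfW (hstep s hs)).1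
  have hwfP : ∀ c < (g.step g.S).n, wfD (IntervalD.aget (g.P g.S) c) = true := fun c hc =>
    GridCD.of_all_range (hpwf g.S le_rfl) c (by rw [← hn g.S]; exact hc)
  have hpsubS : ∀ c < (g.step g.S).n,
      IntervalD.subset (IntervalD.aget (g.P g.S) c) (IntervalD.aget (g.step g.S).W c) = true := fun c hc =>
    GridCD.of_all_range (hpsub g.S le_rfl) c (by rw [← hn g.S]; exact hc)
  -- the run of `u` and its flat start `ŷ`
  set Su := F.windowRunMap ε₀ α (F.preclampY u) (F.preclampTail u) with hSudef
  have hSu : F.IsRunFrom ε₀ α (F.preclampY u) (F.preclampTail u) Su := F.isRunFrom_windowRunMap hε hW hα hEb hEt hu.1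
  have hfu : ∀ t ∈ Icc 0 F.τhi, HasDerivWithinAt (F.flatRun Su) (termField (Tf u t) (F.flatRun Su t)) (Icc 0 F.τhi) t := by
    intro t ht
    have h := F.hasDerivWithinAt_flatRun hSu ht
    rwa [← hTf u hu t] at h
  have hclamp0 : clampUnit 0 = 0 := by simp only [clampUnit]; norm_num
  have ha0 : F.flatRun Su 0 = fun c : F.SIdx => F.yc c.1 ((c.2 : ℕ) : ℤ) := by
    funext c
    rw [F.flatRun_zero hSu c, F.preclampY_natCast]
    have hu0 : u.1 c.1 c.2 = 0 := by rw [h1]; rfl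
    rw [hu0, hclamp0, mul_zero, add_zero]
  have haW : (fun c : F.SIdx => F.yc c.1 ((c.2 : ℕ) : ℤ)) ∈ boxSet (boxOf e (g.step 0).W) :=
    M.hW0 _ fun c => by simp [(F.a_pos c.1 _).le]
  -- times
  have hτc := F.τc_gt
  have hrτ := F.rτ_pos
  have htS' : g.t g.S ≤ F.τhi := M.htS.trans (by unfold τhi; linarith)
  have hτ' : F.τhi - g.t g.S ∈ Icc 0 (g.h g.S).toReal := ⟨by linarith, by linarith [M.hTS]⟩
  have ht : F.τc - g.t g.S ∈ Icc 0 (F.τhi - g.t g.S) := ⟨by linarith [M.htS], by unfold τhi; linarith⟩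
  -- the point-box chain: the run is its own reference run
  obtain ⟨hPS, -, -⟩ := g.mem_start_of_gridCE e hn hRDc (hRD u hu) hstep hinit hprod hpwf hpsub
    hplink hwlink htS' hP0 ha0 hfu haW ha0 hfu g.S le_rfl
  -- the final step up to the flight end, read at `τc`
  have ht0S : 0 ≤ g.t g.S := g.t_nonneg fun k hk => hh k hk.le
  have hrun : ∀ r ∈ Icc 0 (F.τhi - g.t g.S), HasDerivWithinAt (fun r => F.flatRun Su (g.t g.S + r))
      (termField (Tf u (g.t g.S + r)) (F.flatRun Su (g.t g.S + r))) (Icc 0 (F.τhi - g.t g.S)) r :=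
    fun r hr => hasDerivWithinAt_shift (S := F.flatRun Su) (S' := fun t => termField (Tf u t) (F.flatRun Su t)) hfu ht0S
      (by linarith) hr
  have hPS' : F.flatRun Su (g.t g.S) ∈ boxSet (boxOf (g.es e hn g.S) (g.P g.S)) := by rw [GridD.boxOf_es]; exact hPS
  have hmem := (g.step g.S).toRoughStepD.end_mem_onI (g.es e hn g.S) (hRDc g.S le_rfl) (hRD u hu g.S le_rfl) hc'.1
    hwfP hpsubS hPS' hτ' (Su := fun r => F.flatRun Su (g.t g.S + r)) (by simp) hrun ht hTI (i, F.widx hk)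
  simp only [GridD.es_val] at hmem
  rw [show g.t g.S + (F.τc - g.t g.S) = F.τc by ring] at hmem
  have hZc := IntervalD.mem_of_subset (hzlink _ (e (i, F.widx hk)).isLt) hmem
  -- the run of `u` at its flight time is that value
  have hτu : F.preclampTau u = F.τc := by simp only [preclampTau, h2, hclamp0, mul_zero, add_zero]
  have hval : F.runAt ε₀ α u i kk = F.flatRun Su F.τc (i, F.widx hk) := by
    simp only [runAt, slice_apply, flatRun, F.natCast_widx hk, hτu, hSudef]
  rw [hval]
  simp only [K3D.zlo, K3D.zhi, dif_pos hk, hek]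
  exact ⟨hZc.1, hZc.2⟩

/-- **THE RENORMALISATION FACTOR OF EVERY ADMISSIBLE RUN AT ITS FLIGHT TIME LIES IN `G`.** [cite: Tao2016AveragedNS, §5.3; Moore1979, §3.2 and §8.1; cell vocabulary, harvest/h2-tao-ladder rung1/RUNG1-P2G9-REPORT.md §37 (hgl)] -/
theorem gfac_mem_of_gridCE (hε : 0 ≤ ε₀) (hα : IsCancellingCoeff α)
    (hEb : ∀ i, |F.tubeC i (-1)| + F.tubeR (-1) ≤ F.Eb) (hEt : ∀ i, |F.tubeC i F.W| + F.tubeR F.W ≤ F.Et)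
    (M : F.FrameMatch g.toGridD kd e R) (hkn : kd.rs.n = g.n)
    (Tc : ℕ → κ → BTerm F.SIdx) (rows : F.SIdx → List κ) (Tf : F.Space → ℝ → κ → BTerm F.SIdx)
    (hTf : ∀ u t x, termField (Tf u t) x = F.wfieldFlat ε₀ α (F.preclampTail u) t x)
    (hRDc : ∀ s ≤ g.S, IsRTEncl (g.es e M.hn s) (Tc s) (Tc s) rows (g.step s).RD)
    (hRD : ∀ u : F.Space, ∀ s ≤ g.S, ∀ r ∈ Ico 0 (g.h s).toReal,
      IsRTEncl (g.es e M.hn s) (Tc s) (Tf u (g.t s + r)) rows (g.step s).RD)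
    (hstep : ∀ s ≤ g.S, g.stepOK s = true) (hinit : g.initOK = true) (hprod : ∀ s < g.S, g.prodOKE s = true)
    (hprodS : g.prodOK g.S = true)
    (hpwf : ∀ s ≤ g.S, g.pwfOK s = true) (hpsub : ∀ s ≤ g.S, g.psubOK s = true)
    (hplink : ∀ s < g.S, g.plinkOK s = true) (hwlink : ∀ s < g.S, g.wlinkOK s = true) (hK1 : g.linkK1 kd = true)
    (hP0 : (fun c : F.SIdx => F.yc c.1 ((c.2 : ℕ) : ℤ)) ∈ boxSet (boxOf e (g.P 0)))
    {w : F.Space} (hw : F.Adm w) :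
    IntervalD.mem (gfac (slice (F.windowRunMap ε₀ α (F.preclampY w) (F.preclampTail w)) (F.preclampTau w))) kd.rs.G := by
  classical
  have hW1 := M.hW1
  have hn := M.hn
  have hW : 0 < F.W := lt_trans zero_lt_one hW1
  obtain ⟨-, hZb, -, -, he0, hG, -, -⟩ := g.of_linkK1 hK1
  set ek : F.SIdx ≃ Fin kd.rs.n := e.trans (finCongr hkn.symm) with hekdef
  have hek : ∀ p : F.SIdx, ((ek p : Fin kd.rs.n) : ℕ) = (e p : ℕ) := fun p => by simp [hekdef]
  -- facts of the final step
  have hchkS : (g.step g.S).check = true := by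
    have := hstep g.S le_rfl
    simp only [GridD.stepOK, Bool.and_eq_true, decide_eq_true_eq] at this
    exact this.1
  have hc' : (g.step g.S).toRoughStepD.check = true ∧ (g.step g.S).checkPair = true := by
    simpa [PairStepD.check, Bool.and_eq_true] using hchkS
  have hrc' : (g.step g.S).toRoughStepD.centre.check = true ∧ (g.step g.S).toRoughStepD.checkKZ = true := by
    simpa [RoughStepD.check, Bool.and_eq_true] using hc'.1
  obtain ⟨heta, hKZ⟩ := (g.step g.S).toRoughStepD.of_checkKZ hrc'.2
  have hcw := (g.step g.S).toRoughStepD.centre.of_checkWith (by rw [← CentreStepD.check_eq]; exact hrc'.1)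
  have hwfS : ∀ c < (g.step g.S).n, wfsD (IntervalD.aget (g.step g.S).S c) = true := fun c hc => (hcw.2.2.1 c hc).2.1
  have hZ : ∀ c < (g.step g.S).n, 0 ≤ (RoughStepD.dget (g.step g.S).Zh c).toReal := fun c hc => (hKZ c hc).1
  have hHsZb : ∀ x ∈ boxSet (boxOf e (g.step g.S).Hs), ∀ c, IntervalD.mem (x c) (IntervalD.aget kd.rs.Zb (ek c)) := by
    intro x hx c
    have hx' : x ∈ boxSet (boxOf (g.es e hn g.S) (g.step g.S).Hs) := by rw [GridD.boxOf_es]; exact hx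
    have h := (g.step g.S).toRoughStepD.mem_of_mem_Hs (g.es e hn g.S) hwfS hZ heta hx' c
    rw [GridD.es_val] at h
    rw [hek]
    exact IntervalD.mem_of_subset (hZb _ (e c).isLt) h
  -- the run of `w` and the reference run
  set Sw := F.windowRunMap ε₀ α (F.preclampY w) (F.preclampTail w) with hSwdef
  have hSw : F.IsRunFrom ε₀ α (F.preclampY w) (F.preclampTail w) Sw := F.isRunFrom_windowRunMap hε hW hα hEb hEt hw
  have hfw : ∀ t ∈ Icc 0 F.τhi, HasDerivWithinAt (F.flatRun Sw) (termField (Tf w t) (F.flatRun Sw t)) (Icc 0 F.τhi) t := by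
    intro t ht
    have h := F.hasDerivWithinAt_flatRun hSw ht
    rwa [← hTf w t] at h
  set Sc := F.windowRunMap ε₀ α (F.preclampY (F.zeroWin w)) (F.preclampTail (F.zeroWin w)) with hScdef
  have hSc : F.IsRunFrom ε₀ α (F.preclampY (F.zeroWin w)) (F.preclampTail (F.zeroWin w)) Sc :=
    F.isRunFrom_windowRunMap hε hW hα hEb hEt (F.adm_zeroWin hw)
  have hfc : ∀ t ∈ Icc 0 F.τhi, HasDerivWithinAt (F.flatRun Sc) (termField (Tf w t) (F.flatRun Sc t)) (Icc 0 F.τhi) t := by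
    intro t ht
    have h := F.hasDerivWithinAt_flatRun hSc ht
    rwa [F.preclampTail_zeroWin, ← hTf w t] at h
  have hSc0 : F.flatRun Sc 0 = fun c : F.SIdx => F.yc c.1 ((c.2 : ℕ) : ℤ) := funext fun c => F.flatRun_zeroWin_zero hSc c
  have ha : F.flatRun Sw 0 ∈ boxSet (boxOf e (g.step 0).W) := M.hW0 _ fun c => F.abs_flatRun_zero_sub_yc_le hSw c
  -- times
  have hτc := F.τc_gt
  have hrτ := F.rτ_pos
  have htS' : g.t g.S ≤ F.τhi := M.htS.trans (by unfold τhi; linarith)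
  have hTS' : F.τhi ≤ g.t g.S + (g.h g.S).toReal := M.hTS.le
  have hτw := F.preclampTau_mem_box w
  have hτw' : F.preclampTau w ∈ Icc (g.t g.S) F.τhi := ⟨M.htS.trans hτw.1, hτw.2⟩
  -- the grid: the run is in the final hull at its flight time
  obtain ⟨-, hhull⟩ := g.exists_flowSlope_of_gridC_uptoE e hn hRDc (hRD w) hstep hinit hprod hprodS hpwf hpsub hplink hwlink htS'
    hTS' hP0 hSc0 hfc ha ha (Su := F.flatRun Sw) (Sv := F.flatRun Sw) rfl rfl hfw hfw
  have hz1 : ∀ i : Fin m, IntervalD.mem (Sw i 1 (F.preclampTau w)) (IntervalD.aget kd.rs.Zb (ek (i, ⟨1, hW1⟩))) := fun i => by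
    have h := hHsZb _ (hhull _ hτw').1 (i, ⟨1, hW1⟩)
    simpa [flatRun] using h
  have hidx1' : ∀ i : Fin m, ResSlopeD.natget kd.rs.idx1 i = (ek (i, ⟨1, hW1⟩) : ℕ) := fun i => by rw [hek]; exact M.hidx1 i
  have hE := ResSlopeD.mem_energyBox_of ek hW1 M.hm hidx1' (z := slice Sw (F.preclampTau w)) (fun i => by simpa using hz1 i)
  unfold gfac
  exact mem_rsqrt_of_gCert hG he0 ⟨hE.1, hE.2⟩

/-- **THE `g`-HULL CLAUSE FROM THE CENTRED GRID**: with the hypotheses of `gfac_mem_of_gridC` and the two comparisons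
`gLo ≤ G.lo`, `G.hi ≤ gHi`, every admissible point's run has `gLo ≤ g ≤ gHi` at its flight time (the all-runs form of
`hgl`, part VI `gl_of_runs`, specialised to the window-run map). [cite: Tao2016AveragedNS, §5.3; cell vocabulary, harvest/h2-tao-ladder rung1/RUNG1-P2G9-REPORT.md §37 (hgl)] -/
theorem gl_of_gridCE (hε : 0 ≤ ε₀) (hα : IsCancellingCoeff α)
    (hEb : ∀ i, |F.tubeC i (-1)| + F.tubeR (-1) ≤ F.Eb) (hEt : ∀ i, |F.tubeC i F.W| + F.tubeR F.W ≤ F.Et)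
    (M : F.FrameMatch g.toGridD kd e R) (hkn : kd.rs.n = g.n)
    (Tc : ℕ → κ → BTerm F.SIdx) (rows : F.SIdx → List κ) (Tf : F.Space → ℝ → κ → BTerm F.SIdx)
    (hTf : ∀ u t x, termField (Tf u t) x = F.wfieldFlat ε₀ α (F.preclampTail u) t x)
    (hRDc : ∀ s ≤ g.S, IsRTEncl (g.es e M.hn s) (Tc s) (Tc s) rows (g.step s).RD)
    (hRD : ∀ u : F.Space, ∀ s ≤ g.S, ∀ r ∈ Ico 0 (g.h s).toReal,
      IsRTEncl (g.es e M.hn s) (Tc s) (Tf u (g.t s + r)) rows (g.step s).RD)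
    (hstep : ∀ s ≤ g.S, g.stepOK s = true) (hinit : g.initOK = true) (hprod : ∀ s < g.S, g.prodOKE s = true)
    (hprodS : g.prodOK g.S = true)
    (hpwf : ∀ s ≤ g.S, g.pwfOK s = true) (hpsub : ∀ s ≤ g.S, g.psubOK s = true)
    (hplink : ∀ s < g.S, g.plinkOK s = true) (hwlink : ∀ s < g.S, g.wlinkOK s = true) (hK1 : g.linkK1 kd = true)
    (hP0 : (fun c : F.SIdx => F.yc c.1 ((c.2 : ℕ) : ℤ)) ∈ boxSet (boxOf e (g.P 0)))
    {gLo gHi : ℝ} (hGlo : gLo ≤ kd.rs.G.lo.toReal) (hGhi : kd.rs.G.hi.toReal ≤ gHi) :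
    ∀ w, F.Adm w →
      gLo ≤ gfac (slice (F.windowRunMap ε₀ α (F.preclampY w) (F.preclampTail w)) (F.preclampTau w)) ∧
      gfac (slice (F.windowRunMap ε₀ α (F.preclampY w) (F.preclampTail w)) (F.preclampTau w)) ≤ gHi := by
  intro w hw
  have h := F.gfac_mem_of_gridCE hε hα hEb hEt M hkn Tc rows Tf hTf hRDc hRD hstep hinit hprod hprodS hpwf hpsub hplink hwlink hK1
    hP0 hw
  exact ⟨hGlo.trans h.1, h.2.trans hGhi⟩

end Glue

end OneShiftFrame

end DSSOneShift

end Summit.NavierStokesRegularity.NavierStokesRegularity.Theorems
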